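import Literature.MeasureTheory.Group.ConjClassClosedEmbedding
import Literature.NumberTheory.Automorphic.UnitaryGroupFormTransport
import HarnessLib

/-!
# Closed `GL_n`-class ⇒ closed `U(J)`-class: the conjugacy classes of a unitary group inside a closed stable class are
# (relatively open, hence) CLOSED
(Rogawski 1990 §3.1–§3.2 «the classes inside a stable class are parametrised by `𝔇(T/F)`»; Getz–Hahn, GTM 300 (2024),
§17.3–§17.4)

Topic `NumberTheory/Automorphic`; namespace `Literature.NumberTheory.Automorphic` (next to ★ `unitaryGroupOfForm`, ★ `formCongr`).
THEOREMS ONLY (no definition, no instance, no named fact, no `sorry`).  Written for the cell `pub/hodgecm-mathlib` (ENGINE T1):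
the `U(J)`-half of «regular semisimple conjugacy classes of `U(H)(L⁺_v)` are closed ⇒ local orbital integrals converge»
(sequel `LocalRegularOrbitClosed`; `GL`-half ★ `LinearAlgebra/Matrix/RegularSemisimpleConjClassClosed`; analytic input ★
`Analysis/Calculus/SquareRootNearOne`; topological input ★ `MeasureTheory/Group/ConjClassClosedEmbedding`).

Setting: `R` a commutative (topological) ring, `σ : R →+* R`, `J ∈ M_n(R)`, `U(σ, J) = {g ∈ GL_n(R) ∣ σ(g)ᵀ J g = J}` (★
`unitaryGroupOfForm`), the transported forms `Q(h) = σ(h)ᵀ J h` (★ `formCongr σ h J`).  For `γ ∈ U(σ, J)` and `h ∈ GL_n(R)`,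
`h γ h⁻¹ ∈ U(σ, J)` iff `γ` preserves `Q(h)` (★ `conj_mem_unitaryGroupOfForm_iff`).

* §3 ALGEBRA (any commutative ring): `formCongr_mul`, `formCongr_mul_of_mem`, `mul_inv_mem_unitaryGroupOfForm_of_formCongr_eq`,
  **`exists_mem_unitaryGroupOfForm_conj_eq_of_formCongr_eq`** — the ORBIT CRITERION: if `a ∈ GL_n(R)` commutes with `γ` and
  `Q(h′) = σ(a)ᵀ Q(h) a` then `h′ γ h′⁻¹` and `h γ h⁻¹` are `U(σ, J)`-conjugate (the cocycle `h ↦ [Q(h)]` with values in forms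
  modulo `T_γ`-congruence separates the `U`-classes in the stable class [Rogawski1990 §3.1]); `inv_mul_mul_eq_mul_inv_mul_of_mem_mem`
  (`Q₀⁻¹ Q₁` commutes with `γ` when `γ` preserves both), `map_transpose_formCongr` (hermitian), `inv_mul_map_transpose_mul_eq`
  (`Q₀⁻¹ Q₁` is `Q₀`-self-adjoint), `adjoint_mul_self`, `mul_mul_self_eq_of_adjoint_eq`, `isUnit_det_formCongr`.
* §4 TOPOLOGY (`R` topological, `σ` a continuous involution, `J` hermitian with unit determinant, `GL_n(R)` σ-compact locally
  compact Hausdorff, and SQUARE ROOTS NEAR `1` in `M_n(R)` — hypothesis `hsq`, supplied for `R = ∏_{w∣v} E_w` by ★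
  `exists_isOpen_injOn_mul_self_matrix_pi`): `continuous_formCongr`; **`exists_isOpen_forall_conj_of_mem`** — if the `GL_n(R)`-class
  of `γ` is closed, every `U`-class inside `𝒪_{GL}(γ) ∩ U(σ, J)` is relatively OPEN (for `Q(h)` near `Q(h₀)` the matrix
  `m = Q(h₀)⁻¹ Q(h)` is near `1`, commutes with `γ`, is `Q(h₀)`-self-adjoint; its square root `a` near `1` is unique, hence inherits
  both properties, so `Q(h) = σ(a)ᵀ Q(h₀) a` and the orbit criterion applies; the open-map input is ★
  `isOpenMap_conj_codRestrict_of_isClosed`); **`isClosed_unitaryGroupOfForm_conjClass_of_isClosed`** — hence every `U`-class of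
  `γ ∈ U(σ, J)` is CLOSED in `GL_n(R)`; **`isClosed_conjClass_unitaryGroupOfForm_of_isClosed`** — and closed in the topological
  group `↥U(σ, J)`.

## References
* J. Rogawski, *Automorphic Representations of Unitary Groups in Three Variables* (1990), §3.1–§3.2 pp. 19–21 [Rogawski1990].
* J. R. Getz, H. Hahn, *An Introduction to Automorphic Representations*, GTM 300 (2024), §17.3 (orbits and local
  closedness), Thm. 17.4.1 [GetzHahn2024].
-/

noncomputable section

open Filter Topology Set
open scoped Matrix MatrixGroups

namespace Literature.NumberTheory.Automorphic

/-! ## §3 The transported forms `Q(h) = σ(h)ᵀ J h` and the `U(J)`-classes inside a `GL`-class (algebra, any commutative ring) -/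

section FormAlgebra

variable {R : Type*} [CommRing R] {n : Type*} [Fintype n] [DecidableEq n] (σ : R →+* R) (J : Matrix n n R)

/-- `Q(h a) = σ(a)ᵀ Q(h) a`: transporting along a product. [cite: Rogawski1990, §3.1 p. 19] -/
theorem formCongr_mul (h a : GL n R) : formCongr σ (h * a) J = formCongr σ a (formCongr σ h J) := by
  simp only [formCongr, Units.val_mul, Matrix.map_mul, Matrix.transpose_mul, Matrix.mul_assoc]

/-- Elements of `U(σ, J)` do not change the transported form: `Q(u h) = Q(h)` for `u ∈ U(σ, J)`. [cite: Rogawski1990, §3.1 p. 19] -/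
theorem formCongr_mul_of_mem {u : GL n R} (hu : u ∈ unitaryGroupOfForm σ J) (h : GL n R) :
    formCongr σ (u * h) J = formCongr σ h J := by
  rw [formCongr_mul]
  exact congrArg (formCongr σ h) hu

/-- `Q(k') = Q(k)` forces `k' k⁻¹ ∈ U(σ, J)`. [cite: Rogawski1990, §3.1 p. 19] -/
theorem mul_inv_mem_unitaryGroupOfForm_of_formCongr_eq {k k' : GL n R} (hkk : formCongr σ k' J = formCongr σ k J) :
    k' * k⁻¹ ∈ unitaryGroupOfForm σ J := by
  rw [mem_unitaryGroupOfForm_iff]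
  change formCongr σ (k' * k⁻¹) J = J
  rw [formCongr_mul, hkk, formCongr_inv_formCongr]

/-- **The orbit criterion (sufficiency).**  If `a ∈ GL_n(R)` commutes with `γ` and `Q(h') = σ(a)ᵀ Q(h) a`, then
`h' γ h'⁻¹` and `h γ h⁻¹` are conjugate under `U(σ, J)`: `u = h' (h a)⁻¹ ∈ U(σ, J)` does it.  (This is the easy half of
«the `U`-classes inside the stable class of `γ` are parametrised by `𝔇(T_γ)`», with the cocycle read on forms.)
[cite: Rogawski1990, §3.1 p. 19] -/
theorem exists_mem_unitaryGroupOfForm_conj_eq_of_formCongr_eq (γ h h' a : GL n R) (ha : a * γ = γ * a)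
    (hQ : formCongr σ h' J = formCongr σ a (formCongr σ h J)) :
    ∃ u ∈ unitaryGroupOfForm σ J, u * (h * γ * h⁻¹) * u⁻¹ = h' * γ * h'⁻¹ := by
  refine ⟨h' * (h * a)⁻¹, mul_inv_mem_unitaryGroupOfForm_of_formCongr_eq σ J (by rw [formCongr_mul]; exact hQ), ?_⟩
  have hγ : a⁻¹ * γ * a = γ := by
    rw [mul_assoc, ← ha, inv_mul_cancel_left]
  calc h' * (h * a)⁻¹ * (h * γ * h⁻¹) * (h' * (h * a)⁻¹)⁻¹
      = h' * (a⁻¹ * γ * a) * h'⁻¹ := by simp only [mul_inv_rev, inv_inv, mul_assoc, inv_mul_cancel_left]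
    _ = h' * γ * h'⁻¹ := by rw [hγ]

/-- If `γ` preserves two forms `Q₀` (invertible) and `Q₁`, then `Q₀⁻¹ Q₁` commutes with `γ`. [cite: Rogawski1990, §3.1 p. 19] -/
theorem inv_mul_mul_eq_mul_inv_mul_of_mem_mem {Q₀ Q₁ : Matrix n n R} (hQ₀ : IsUnit Q₀.det) {γ : GL n R}
    (h₀ : γ ∈ unitaryGroupOfForm σ Q₀) (h₁ : γ ∈ unitaryGroupOfForm σ Q₁) :
    Q₀⁻¹ * Q₁ * (γ : Matrix n n R) = (γ : Matrix n n R) * (Q₀⁻¹ * Q₁) := by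
  rw [mem_unitaryGroupOfForm_iff] at h₀ h₁
  set P : Matrix n n R := (((γ : GL n R) : Matrix n n R).map σ)ᵀ with hP
  have hPu : IsUnit P.det := by
    rw [hP, Matrix.det_transpose, ← RingHom.mapMatrix_apply, ← RingHom.map_det]
    exact (Matrix.isUnits_det_units γ).map σ
  -- `Q₁ γ = P⁻¹ Q₁` and `γ Q₀⁻¹ = Q₀⁻¹ P⁻¹`
  have e₁ : Q₁ * (γ : Matrix n n R) = P⁻¹ * Q₁ := by
    calc Q₁ * (γ : Matrix n n R) = P⁻¹ * (P * Q₁ * (γ : Matrix n n R)) := by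
          rw [Matrix.mul_assoc P, Matrix.nonsing_inv_mul_cancel_left P _ hPu]
      _ = P⁻¹ * Q₁ := by rw [h₁]
  have e₀ : (γ : Matrix n n R) * Q₀⁻¹ = Q₀⁻¹ * P⁻¹ := by
    have h₀' : Q₀ * (γ : Matrix n n R) = P⁻¹ * Q₀ := by
      calc Q₀ * (γ : Matrix n n R) = P⁻¹ * (P * Q₀ * (γ : Matrix n n R)) := by
            rw [Matrix.mul_assoc P, Matrix.nonsing_inv_mul_cancel_left P _ hPu]
        _ = P⁻¹ * Q₀ := by rw [h₀]
    calc (γ : Matrix n n R) * Q₀⁻¹ = Q₀⁻¹ * (Q₀ * (γ : Matrix n n R)) * Q₀⁻¹ := by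
          rw [Matrix.nonsing_inv_mul_cancel_left Q₀ _ hQ₀]
      _ = Q₀⁻¹ * P⁻¹ * (Q₀ * Q₀⁻¹) := by rw [h₀', Matrix.mul_assoc, Matrix.mul_assoc, Matrix.mul_assoc]
      _ = Q₀⁻¹ * P⁻¹ := by rw [Matrix.mul_nonsing_inv Q₀ hQ₀, Matrix.mul_one]
  calc Q₀⁻¹ * Q₁ * (γ : Matrix n n R) = Q₀⁻¹ * (P⁻¹ * Q₁) := by rw [Matrix.mul_assoc, e₁]
    _ = (γ : Matrix n n R) * Q₀⁻¹ * Q₁ := by rw [← Matrix.mul_assoc, ← e₀]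
    _ = (γ : Matrix n n R) * (Q₀⁻¹ * Q₁) := by rw [Matrix.mul_assoc]

/-- Transported forms of a HERMITIAN `J` (`σ(J)ᵀ = J`, `σ` an involution) are hermitian. [cite: Rogawski1990, §3.1 p. 19] -/
theorem map_transpose_formCongr (hJ : (J.map σ)ᵀ = J) (hσ : ∀ x, σ (σ x) = x) (h : GL n R) :
    ((formCongr σ h J).map σ)ᵀ = formCongr σ h J := by
  have hmm : ∀ M : Matrix n n R, (M.map σ).map σ = M := fun M => by
    ext i j; simp only [Matrix.map_apply, hσ]
  simp only [formCongr, Matrix.map_mul, Matrix.transpose_mul, Matrix.transpose_map, Matrix.transpose_transpose, hmm,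
    hJ, Matrix.mul_assoc]

/-- For hermitian `Q₀` (invertible) and `Q₁`, the matrix `m = Q₀⁻¹ Q₁` is self-adjoint for `Q₀`:
`Q₀⁻¹ σ(m)ᵀ Q₀ = m`. [cite: Rogawski1990, §3.1 p. 19] -/
theorem inv_mul_map_transpose_mul_eq {Q₀ Q₁ : Matrix n n R} (hQ₀ : IsUnit Q₀.det) (h₀ : (Q₀.map σ)ᵀ = Q₀)
    (h₁ : (Q₁.map σ)ᵀ = Q₁) : Q₀⁻¹ * ((Q₀⁻¹ * Q₁).map σ)ᵀ * Q₀ = Q₀⁻¹ * Q₁ := by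
  -- `σ(Q₀⁻¹) = σ(Q₀)⁻¹` and `(σ(Q₀)⁻¹)ᵀ = (σ(Q₀)ᵀ)⁻¹ = Q₀⁻¹`
  have hinv : (Q₀⁻¹).map σ = (Q₀.map σ)⁻¹ := by
    refine (Matrix.inv_eq_left_inv ?_).symm
    rw [← Matrix.map_mul, Matrix.nonsing_inv_mul Q₀ hQ₀, Matrix.map_one σ (map_zero σ) (map_one σ)]
  rw [Matrix.map_mul, Matrix.transpose_mul, h₁, hinv, Matrix.transpose_nonsing_inv, h₀, Matrix.mul_assoc,
    Matrix.mul_assoc, Matrix.nonsing_inv_mul Q₀ hQ₀, Matrix.mul_one]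

/-- The adjoint `X ↦ Q₀⁻¹ σ(X)ᵀ Q₀` of a square `a·a` is the square of the adjoint (`Q₀` invertible). [cite: Rogawski1990, §3.1 p. 19] -/
theorem adjoint_mul_self {Q₀ : Matrix n n R} (hQ₀ : IsUnit Q₀.det) (a : Matrix n n R) :
    Q₀⁻¹ * ((a * a).map σ)ᵀ * Q₀ = (Q₀⁻¹ * (a.map σ)ᵀ * Q₀) * (Q₀⁻¹ * (a.map σ)ᵀ * Q₀) := by
  rw [Matrix.map_mul, Matrix.transpose_mul]
  simp only [Matrix.mul_assoc]
  rw [Matrix.mul_nonsing_inv_cancel_left Q₀ _ hQ₀]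

/-- If `a` is self-adjoint for `Q₀` (`Q₀⁻¹ σ(a)ᵀ Q₀ = a`) then `Q₀ · (a·a) = σ(a)ᵀ Q₀ a`. [cite: Rogawski1990, §3.1 p. 19] -/
theorem mul_mul_self_eq_of_adjoint_eq {Q₀ : Matrix n n R} (hQ₀ : IsUnit Q₀.det) {a : Matrix n n R}
    (ha : Q₀⁻¹ * (a.map σ)ᵀ * Q₀ = a) : Q₀ * (a * a) = (a.map σ)ᵀ * Q₀ * a := by
  have key : Q₀ * a = (a.map σ)ᵀ * Q₀ := by
    conv_lhs => rw [← ha]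
    simp only [Matrix.mul_assoc]
    rw [Matrix.mul_nonsing_inv_cancel_left Q₀ _ hQ₀]
  rw [← Matrix.mul_assoc, key]

/-- `det Q(h)` is a unit when `det J` is. [cite: Rogawski1990, §3.1 p. 19] -/
theorem isUnit_det_formCongr (hJu : IsUnit J.det) (h : GL n R) : IsUnit (formCongr σ h J).det := by
  rw [formCongr, Matrix.det_mul, Matrix.det_mul, Matrix.det_transpose, ← RingHom.mapMatrix_apply, ← RingHom.map_det]
  exact (((Matrix.isUnits_det_units h).map σ).mul hJu).mul (Matrix.isUnits_det_units h)

end FormAlgebra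

/-! ## §4 Closed `GL`-class ⇒ closed `U(J)`-class (topology) -/

section FormTopology

variable {R : Type*} [CommRing R] [TopologicalSpace R] [IsTopologicalRing R] {n : Type*} [Fintype n] [DecidableEq n]
  (σ : R →+* R) (J : Matrix n n R)

/-- `h ↦ Q(h) = σ(h)ᵀ J h` is continuous on `GL_n(R)` (`σ` continuous). [cite: Rogawski1990, §3.1 p. 19] -/
theorem continuous_formCongr (hσc : Continuous σ) : Continuous fun h : GL n R => formCongr σ h J :=
  ((Units.continuous_val.matrix_map hσc).matrix_transpose.mul continuous_const).mul Units.continuous_val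

/-- **Local step.**  Let `γ ∈ U(σ, J)` have a CLOSED `GL_n(R)`-conjugacy class, and assume square roots near `1` exist in
`M_n(R)` (`hsq`, e.g. ★ `exists_isOpen_injOn_mul_self_matrix_pi`).  Then for every `h₀` with `h₀ γ h₀⁻¹ ∈ U(σ, J)` there is
an open `W ∋ h₀ γ h₀⁻¹` such that every `h γ h⁻¹ ∈ W ∩ U(σ, J)` is `U(σ, J)`-conjugate to `h₀ γ h₀⁻¹`: the `U`-classes are
relatively open in the stable class.  Mechanism: `m = Q(h₀)⁻¹ Q(h)` is close to `1`, commutes with `γ` and is `Q(h₀)`-self-adjoint;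
its square root `a` near `1` is unique, hence also commutes with `γ` and is self-adjoint, so `Q(h) = σ(a)ᵀ Q(h₀) a` and the
orbit criterion applies. [cite: Rogawski1990, §3.1 p. 19] -/
theorem exists_isOpen_forall_conj_of_mem [SigmaCompactSpace (GL n R)] [LocallyCompactSpace (GL n R)] [T2Space (GL n R)]
    (hσc : Continuous σ) (hσ : ∀ x, σ (σ x) = x) (hJ : (J.map σ)ᵀ = J) (hJu : IsUnit J.det)
    (hsq : ∃ U : Set (Matrix n n R), IsOpen U ∧ (1 : Matrix n n R) ∈ U ∧ Set.InjOn (fun a : Matrix n n R => a * a) U ∧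
      ∀ V ∈ 𝓝 (1 : Matrix n n R), (fun a : Matrix n n R => a * a) '' V ∈ 𝓝 1)
    {γ : GL n R} (hO : IsClosed {x : GL n R | ∃ g : GL n R, g * γ * g⁻¹ = x})
    (h₀ : GL n R) (hh₀ : h₀ * γ * h₀⁻¹ ∈ unitaryGroupOfForm σ J) :
    ∃ W : Set (GL n R), IsOpen W ∧ h₀ * γ * h₀⁻¹ ∈ W ∧ ∀ h : GL n R, h * γ * h⁻¹ ∈ W →
      h * γ * h⁻¹ ∈ unitaryGroupOfForm σ J →
        ∃ u ∈ unitaryGroupOfForm σ J, u * (h₀ * γ * h₀⁻¹) * u⁻¹ = h * γ * h⁻¹ := by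
  obtain ⟨Usq, hUo, hU1, hUinj, hUn⟩ := hsq
  -- the base form `Q₀ = Q(h₀)`, preserved by `γ`, hermitian, invertible
  set Q₀ : Matrix n n R := formCongr σ h₀ J with hQ₀def
  have hQ₀u : IsUnit Q₀.det := isUnit_det_formCongr σ J hJu h₀
  have hγQ₀ : γ ∈ unitaryGroupOfForm σ Q₀ := (conj_mem_unitaryGroupOfForm_iff σ h₀ J γ).1 hh₀
  have hQ₀h : (Q₀.map σ)ᵀ = Q₀ := map_transpose_formCongr σ J hJ hσ h₀
  -- the `Q₀`-adjoint and `γ`-conjugation on `M_n(R)`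
  set adj : Matrix n n R → Matrix n n R := fun X => Q₀⁻¹ * (X.map σ)ᵀ * Q₀ with hadj
  set cj : Matrix n n R → Matrix n n R := fun X => (γ : Matrix n n R) * X * ((γ⁻¹ : GL n R) : Matrix n n R) with hcj
  have hadjc : Continuous adj := ((continuous_const.mul (continuous_id.matrix_map hσc).matrix_transpose).mul
    continuous_const)
  have hcjc : Continuous cj := (continuous_const.mul continuous_id).mul continuous_const
  have hadj1 : adj 1 = 1 := by
    simp only [hadj, Matrix.map_one σ (map_zero σ) (map_one σ), Matrix.transpose_one, Matrix.mul_one,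
      Matrix.nonsing_inv_mul Q₀ hQ₀u]
  have hcj1 : cj 1 = 1 := by
    simp only [hcj, Matrix.mul_one, ← Units.val_mul, mul_inv_cancel, Units.val_one]
  -- the neighbourhood `V` of `1` on which squaring is injective even after adjoint / conjugation
  set V : Set (Matrix n n R) := Usq ∩ adj ⁻¹' Usq ∩ cj ⁻¹' Usq with hV
  have hVo : IsOpen V := (hUo.inter (hUo.preimage hadjc)).inter (hUo.preimage hcjc)
  have hV1 : (1 : Matrix n n R) ∈ V := ⟨⟨hU1, by rw [Set.mem_preimage, hadj1]; exact hU1⟩,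
    by rw [Set.mem_preimage, hcj1]; exact hU1⟩
  have hN₁ : (fun a : Matrix n n R => a * a) '' V ∈ 𝓝 (1 : Matrix n n R) := hUn V (hVo.mem_nhds hV1)
  -- `μ h = Q₀⁻¹ Q(h)` is continuous with `μ h₀ = 1`
  set μ : GL n R → Matrix n n R := fun h => Q₀⁻¹ * formCongr σ h J with hμ
  have hμc : Continuous μ := continuous_const.mul (continuous_formCongr σ J hσc)
  have hμ₀ : μ h₀ = 1 := by simp only [hμ, ← hQ₀def, Matrix.nonsing_inv_mul Q₀ hQ₀u]
  have hS : μ ⁻¹' ((fun a : Matrix n n R => a * a) '' V) ∈ 𝓝 h₀ :=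
    hμc.continuousAt.preimage_mem_nhds (by rw [hμ₀]; exact hN₁)
  set W₀ : Set (GL n R) := interior (μ ⁻¹' ((fun a : Matrix n n R => a * a) '' V)) with hW₀
  have hW₀o : IsOpen W₀ := isOpen_interior
  have hh₀W₀ : h₀ ∈ W₀ := mem_interior_iff_mem_nhds.2 hS
  -- push `W₀` through the OPEN orbit map `GL_n(R) → 𝒪(γ)`
  have hPi := Literature.MeasureTheory.Group.isOpenMap_conj_codRestrict_of_isClosed γ hO
  obtain ⟨W, hWo, hWeq⟩ := isOpen_induced_iff.1 (hPi W₀ hW₀o)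
  refine ⟨W, hWo, ?_, ?_⟩
  · have : Set.rangeFactorization (fun y : GL n R => y * γ * y⁻¹) h₀ ∈ Subtype.val ⁻¹' W := by
      rw [hWeq]; exact Set.mem_image_of_mem _ hh₀W₀
    exact this
  intro h hhW hhU
  -- `h γ h⁻¹ = h₁ γ h₁⁻¹` for some `h₁ ∈ W₀`
  have hmem : Set.rangeFactorization (fun y : GL n R => y * γ * y⁻¹) h ∈ Subtype.val ⁻¹' W := hhW
  rw [hWeq] at hmem
  obtain ⟨h₁, hh₁W₀, hh₁⟩ := hmem
  have hh₁h : h₁ * γ * h₁⁻¹ = h * γ * h⁻¹ := congrArg Subtype.val hh₁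
  rw [← hh₁h] at hhU ⊢
  -- the square root
  have hμ₁ : h₁ ∈ μ ⁻¹' ((fun a : Matrix n n R => a * a) '' V) := interior_subset hh₁W₀
  obtain ⟨a, haV, haa⟩ := hμ₁
  set Q₁ : Matrix n n R := formCongr σ h₁ J with hQ₁def
  have hγQ₁ : γ ∈ unitaryGroupOfForm σ Q₁ := (conj_mem_unitaryGroupOfForm_iff σ h₁ J γ).1 hhU
  have hQ₁h : (Q₁.map σ)ᵀ = Q₁ := map_transpose_formCongr σ J hJ hσ h₁
  have haa' : a * a = Q₀⁻¹ * Q₁ := haa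
  -- `m = Q₀⁻¹ Q₁` commutes with `γ` and is self-adjoint
  have hmγ : Q₀⁻¹ * Q₁ * (γ : Matrix n n R) = (γ : Matrix n n R) * (Q₀⁻¹ * Q₁) :=
    inv_mul_mul_eq_mul_inv_mul_of_mem_mem σ hQ₀u hγQ₀ hγQ₁
  have hmadj : adj (Q₀⁻¹ * Q₁) = Q₀⁻¹ * Q₁ := inv_mul_map_transpose_mul_eq σ hQ₀u hQ₀h hQ₁h
  obtain ⟨⟨haU, haadj⟩, hacj⟩ := haV
  -- uniqueness of the square root: `γ a γ⁻¹ = a`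
  have hcja : cj a = a := by
    refine hUinj hacj haU ?_
    change cj a * cj a = a * a
    have : cj a * cj a = cj (a * a) := by
      simp only [hcj, Matrix.mul_assoc, Units.inv_mul_cancel_left]
    rw [this, haa', hcj]
    change (γ : Matrix n n R) * (Q₀⁻¹ * Q₁) * ((γ⁻¹ : GL n R) : Matrix n n R) = Q₀⁻¹ * Q₁
    rw [← hmγ, Matrix.mul_assoc, ← Units.val_mul, mul_inv_cancel, Units.val_one, Matrix.mul_one]
  -- uniqueness of the square root: `a† = a`
  have hadja : adj a = a := by
    refine hUinj haadj haU ?_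
    change adj a * adj a = a * a
    rw [← adjoint_mul_self σ hQ₀u a, haa']
    exact hmadj
  -- `a` is invertible and commutes with `γ`
  have hadet : IsUnit a.det := by
    have h2 : IsUnit (a * a).det := by
      rw [haa', Matrix.det_mul]
      exact (Matrix.isUnit_nonsing_inv_det Q₀ hQ₀u).mul (isUnit_det_formCongr σ J hJu h₁)
    rw [Matrix.det_mul] at h2
    exact isUnit_of_mul_isUnit_left h2
  set au : GL n R := ((Matrix.isUnit_iff_isUnit_det a).2 hadet).unit with hau
  have hau_val : (au : Matrix n n R) = a := ((Matrix.isUnit_iff_isUnit_det a).2 hadet).unit_spec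
  have hcomm : au * γ = γ * au := by
    apply Units.val_injective
    simp only [Units.val_mul, hau_val]
    have e := congrArg (fun X => X * (γ : Matrix n n R)) hcja
    simp only [hcj, Matrix.mul_assoc, Units.inv_mul, Matrix.mul_one] at e
    exact e.symm
  have hQ : formCongr σ h₁ J = formCongr σ au (formCongr σ h₀ J) := by
    change Q₁ = ((au : Matrix n n R).map σ)ᵀ * Q₀ * (au : Matrix n n R)
    rw [hau_val, ← mul_mul_self_eq_of_adjoint_eq σ hQ₀u hadja, haa', Matrix.mul_nonsing_inv_cancel_left Q₀ _ hQ₀u]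
  exact exists_mem_unitaryGroupOfForm_conj_eq_of_formCongr_eq σ J γ h₀ h₁ au hcomm hQ

/-- **Closed `GL_n(R)`-class ⇒ closed `U(σ, J)`-class.**  For `σ` a continuous involution, `J` hermitian with `det J` a unit,
square roots near `1` in `M_n(R)` (`hsq`), and `GL_n(R)` σ-compact, locally compact, Hausdorff: if the `GL_n(R)`-conjugacy
class of `γ ∈ U(σ, J)` is closed, then so is its `U(σ, J)`-conjugacy class `{u γ u⁻¹ ∣ u ∈ U(σ, J)} ⊆ GL_n(R)`.  Proof: inside the
closed «stable class» `𝒪_{GL}(γ) ∩ U(σ, J)` every `U`-class is relatively open (`exists_isOpen_forall_conj_of_mem`), so each is the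
complement of the union of the others, hence relatively closed. [cite: Rogawski1990, §3.1 p. 19] -/
theorem isClosed_unitaryGroupOfForm_conjClass_of_isClosed [SigmaCompactSpace (GL n R)] [LocallyCompactSpace (GL n R)]
    [T2Space (GL n R)] [T2Space R] (hσc : Continuous σ) (hσ : ∀ x, σ (σ x) = x) (hJ : (J.map σ)ᵀ = J)
    (hJu : IsUnit J.det)
    (hsq : ∃ U : Set (Matrix n n R), IsOpen U ∧ (1 : Matrix n n R) ∈ U ∧ Set.InjOn (fun a : Matrix n n R => a * a) U ∧
      ∀ V ∈ 𝓝 (1 : Matrix n n R), (fun a : Matrix n n R => a * a) '' V ∈ 𝓝 1)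
    {γ : GL n R} (hγ : γ ∈ unitaryGroupOfForm σ J) (hO : IsClosed {x : GL n R | ∃ g : GL n R, g * γ * g⁻¹ = x}) :
    IsClosed {x : GL n R | ∃ u ∈ unitaryGroupOfForm σ J, u * γ * u⁻¹ = x} := by
  set U := unitaryGroupOfForm σ J with hUdef
  have hconj : ∀ {u : GL n R}, u ∈ U → u * γ * u⁻¹ ∈ U := fun hu => U.mul_mem (U.mul_mem hu hγ) (U.inv_mem hu)
  have hCsub : {x : GL n R | ∃ u ∈ U, u * γ * u⁻¹ = x} ⊆ {x | ∃ g : GL n R, g * γ * g⁻¹ = x} ∩ (U : Set (GL n R)) := by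
    rintro _ ⟨u, hu, rfl⟩
    exact ⟨⟨u, rfl⟩, hconj hu⟩
  have hUc : IsClosed (U : Set (GL n R)) := by
    have e : (U : Set (GL n R)) = {h : GL n R | formCongr σ h J = J} := Set.ext fun _ => Iff.rfl
    rw [e]
    exact isClosed_eq (continuous_formCongr σ J hσc) continuous_const
  have hSt : IsClosed ({x | ∃ g : GL n R, g * γ * g⁻¹ = x} ∩ (U : Set (GL n R))) := hO.inter hUc
  rw [← isOpen_compl_iff, isOpen_iff_forall_mem_open]
  intro x hx
  by_cases hxSt : x ∈ {x | ∃ g : GL n R, g * γ * g⁻¹ = x} ∩ (U : Set (GL n R))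
  · obtain ⟨⟨h₁, rfl⟩, hxU⟩ := hxSt
    obtain ⟨W, hWo, hxW, hW⟩ := exists_isOpen_forall_conj_of_mem σ J hσc hσ hJ hJu hsq hO h₁ hxU
    refine ⟨W, fun y hyW hyC => ?_, hWo, hxW⟩
    obtain ⟨u, hu, rfl⟩ := hyC
    obtain ⟨u', hu', he⟩ := hW u hyW (hconj hu)
    refine hx ⟨u'⁻¹ * u, U.mul_mem (U.inv_mem hu') hu, ?_⟩
    calc u'⁻¹ * u * γ * (u'⁻¹ * u)⁻¹ = u'⁻¹ * (u * γ * u⁻¹) * u' := by group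
      _ = u'⁻¹ * (u' * (h₁ * γ * h₁⁻¹) * u'⁻¹) * u' := by rw [he]
      _ = h₁ * γ * h₁⁻¹ := by group
  · exact ⟨({x | ∃ g : GL n R, g * γ * g⁻¹ = x} ∩ (U : Set (GL n R)))ᶜ, fun y hy hyC => hy (hCsub hyC),
      hSt.isOpen_compl, hxSt⟩

/-- The same, inside the topological group `U(σ, J)` itself: the conjugacy class `{y γ y⁻¹ ∣ y ∈ U(σ, J)}` of `γ` in
`↥U(σ, J)` is closed as soon as the `GL_n(R)`-class of `γ` is. [cite: Rogawski1990, §3.1 p. 19] -/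
theorem isClosed_conjClass_unitaryGroupOfForm_of_isClosed [SigmaCompactSpace (GL n R)] [LocallyCompactSpace (GL n R)]
    [T2Space (GL n R)] [T2Space R] (hσc : Continuous σ) (hσ : ∀ x, σ (σ x) = x) (hJ : (J.map σ)ᵀ = J)
    (hJu : IsUnit J.det)
    (hsq : ∃ U : Set (Matrix n n R), IsOpen U ∧ (1 : Matrix n n R) ∈ U ∧ Set.InjOn (fun a : Matrix n n R => a * a) U ∧
      ∀ V ∈ 𝓝 (1 : Matrix n n R), (fun a : Matrix n n R => a * a) '' V ∈ 𝓝 1)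
    (γ : unitaryGroupOfForm σ J) (hO : IsClosed {x : GL n R | ∃ g : GL n R, g * (γ : GL n R) * g⁻¹ = x}) :
    IsClosed {x : unitaryGroupOfForm σ J | ∃ y : unitaryGroupOfForm σ J, y * γ * y⁻¹ = x} := by
  have h := (isClosed_unitaryGroupOfForm_conjClass_of_isClosed σ J hσc hσ hJ hJu hsq γ.2 hO).preimage
    (continuous_subtype_val : Continuous (Subtype.val : unitaryGroupOfForm σ J → GL n R))
  convert h using 1
  ext x
  simp only [Set.mem_setOf_eq, Set.mem_preimage]
  constructor
  · rintro ⟨y, rfl⟩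
    exact ⟨y, y.2, rfl⟩
  · rintro ⟨u, hu, hux⟩
    exact ⟨⟨u, hu⟩, Subtype.ext hux⟩

end FormTopology

end Literature.NumberTheory.Automorphic

end
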